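import Summits.Ventures.PercRepro.ProfilePointedAverage

/-!
# PercRepro — THE POINTED CONJECTURE (Ĉ) HOLDS AT EVERY PARALLEL PAIR: IT IS THEOREM A FOR THE MINOR `(M ∖ e) / p`
(p10, gen 13; `proofs/P10-AVFULL.md` §20(4), §21)

`PointedRow` (ProfilePointedAverage) is the pointed conjecture (Ĉ): `(N − k − 1)·P_k ≤ k·P_{k+1} + (N − 2k − 1)·c^p_k`
for `2k + 2 ≤ N`.  When `p` lies in a PARALLEL PAIR `{p, e}` (`ρ{p} = ρ{e} = ρ{p, e} = 1`) no bi-independent set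
extends by `p` (`extCount_parallel`: `c^p_k = 0`), every bi-independent `k`-set contains exactly one of `p, e`, and the
two halves are the bi-independent `(k−1)`-sets of the two-element minors `(M ∖ e) / p` and `(M ∖ p) / e` on `N − 2`
elements (`card_filter_biIndepSets_parallel_half`, `card_biIndepSets_parallel`: `P_k(M) = P_{k−1}((M∖e)/p) +
P_{k−1}((M∖p)/e)`; the two minors are isomorphic by the swap `p ↔ e`, `rk_insert_eq_of_parallel'`).  (Ĉ) is then
Theorem A at level `k − 1` for each minor (`pointedRow_parallel_of_fact`, CONDITIONAL on the named fact
`BiIndepDensityLogConcave`; everything else unconditional) — the TIGHT instance of §20 (uniform + parallel pair).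
Nothing here asserts (Ĉ).
-/

open scoped Matroid

namespace PercRepro.Cogirth

open Finset ThmH Skew

variable {α : Type} [DecidableEq α] {M : Matroid α} [M.Finite]

/-- Parallel elements are interchangeable in every rank: `ρ(Y ∪ f) = ρ(Y ∪ g)` when `ρ{f} = ρ{f, g} = 1`. -/
theorem rk_insert_le_of_parallel' {f g : α} (hf : f ∈ gr M) (hg : g ∈ gr M) (hg1 : rk M {g} = 1)
    (hfg : rk M {f, g} = 1) {Y : Finset α} (hY : Y ⊆ gr M) :
    rk M (insert f Y) ≤ rk M (insert g Y) := by
  have hfcl : f ∈ clF M {g} := by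
    rw [mem_clF_iff_rk_insert_eq hf (singleton_subset_iff.2 hg)]
    rw [show insert f ({g} : Finset α) = {f, g} from rfl, hfg, hg1]
  have hfcl' : f ∈ clF M (insert g Y) :=
    clF_mono_sub (singleton_subset_iff.2 (mem_insert_self g Y)) hfcl
  rw [mem_clF_iff_rk_insert_eq hf (insert_subset hg hY)] at hfcl'
  calc rk M (insert f Y) ≤ rk M (insert f (insert g Y)) :=
        rk_mono' (insert_subset_insert f (subset_insert g Y))
    _ = rk M (insert g Y) := hfcl'

/-- `ρ(Y ∪ f) = ρ(Y ∪ g)` for a parallel pair `{f, g}` of non-loops. -/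
theorem rk_insert_eq_of_parallel' {f g : α} (hf : f ∈ gr M) (hg : g ∈ gr M) (hf1 : rk M {f} = 1)
    (hg1 : rk M {g} = 1) (hfg : rk M {f, g} = 1) {Y : Finset α} (hY : Y ⊆ gr M) :
    rk M (insert f Y) = rk M (insert g Y) :=
  le_antisymm (rk_insert_le_of_parallel' hf hg hg1 hfg hY)
    (rk_insert_le_of_parallel' hg hf hf1 (by rw [pair_comm]; exact hfg) hY)

/-- A full-rank finset does not contain a parallel pair. -/
theorem not_pair_subset_of_parallel' {f g : α} (hfg' : f ≠ g) (hfg : rk M {f, g} = 1) {Y : Finset α}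
    (hY : rk M Y = Y.card) : ¬ ({f, g} : Finset α) ⊆ Y := by
  intro h
  have := rk_eq_card_of_subset_of_rk_eq_card h hY
  rw [card_pair hfg', hfg] at this
  omega

/-- **No bi-independent set extends by an element of a parallel pair**: `c^p_k = 0`. -/
theorem extCount_parallel {p e : α} (hp : p ∈ gr M) (he : e ∈ gr M) (hpe' : p ≠ e)
    (hpe : rk M {p, e} = 1) (k : ℕ) : extCount M k p = 0 := by
  unfold extCount
  rw [card_eq_zero, filter_eq_empty_iff]
  intro X hX
  rintro ⟨hpX, hins⟩
  rw [mem_biIndepSets] at hX hins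
  obtain ⟨hXg, -, -, hXc⟩ := hX
  obtain ⟨-, -, hIr, -⟩ := hins
  by_cases heX : e ∈ X
  · exact not_pair_subset_of_parallel' hpe' hpe hIr
      (insert_subset (mem_insert_self _ _) (singleton_subset_iff.2 (mem_insert_of_mem heX)))
  · exact not_pair_subset_of_parallel' hpe' hpe hXc
      (insert_subset (mem_sdiff.2 ⟨hp, hpX⟩) (singleton_subset_iff.2 (mem_sdiff.2 ⟨he, heX⟩)))

/-- **One half of the bi-independent profile at a parallel pair**: the bi-independent `k`-sets containing `f` (and
hence not `g`) are `BI_{k−1}((M ∖ g) / f)` plus `f`. -/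
theorem card_filter_biIndepSets_parallel_half {f g : α} (hf : f ∈ gr M) (hg : g ∈ gr M) (hfg' : f ≠ g)
    (hf1 : rk M {f} = 1) (hg1 : rk M {g} = 1) (hfg : rk M {f, g} = 1) {k : ℕ} (hk : 1 ≤ k) :
    ((biIndepSets M k).filter (fun X => f ∈ X ∧ g ∉ X)).card =
      (biIndepSets ((M ＼ ({g} : Set α)) ／ ({f} : Set α)) (k - 1)).card := by
  have hfind : (M ＼ ({g} : Set α)).Indep ({f} : Set α) := by
    have h : rk (M ＼ ({g} : Set α)) {f} = ({f} : Finset α).card := by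
      rw [rk_delete (singleton_subset_iff.2 (mem_erase.2 ⟨hfg', hf⟩)), hf1, card_singleton]
    have := indep_of_rk_eq_card' h
    rwa [coe_singleton] at this
  have hgrT : gr ((M ＼ ({g} : Set α)) ／ ({f} : Set α)) = ((gr M).erase g).erase f := by
    rw [gr_contract', gr_delete']
  apply card_bij (fun X _ => X.erase f)
  · intro X hX
    rw [mem_filter, mem_biIndepSets] at hX
    obtain ⟨⟨hXg, hXk, hXr, hXc⟩, hfX, hgX⟩ := hX
    rw [mem_biIndepSets, hgrT]
    have hX'g : X.erase f ⊆ ((gr M).erase g).erase f := by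
      intro x hx
      rw [mem_erase] at hx ⊢
      exact ⟨hx.1, mem_erase.2 ⟨fun h => hgX (h ▸ hx.2), hXg hx.2⟩⟩
    have hX'g' : X.erase f ⊆ (gr (M ＼ ({g} : Set α))).erase f := by rw [gr_delete']; exact hX'g
    refine ⟨hX'g, by rw [card_erase_of_mem hfX, hXk], ?_, ?_⟩
    · have h := rk_contract_add_one hfind hX'g'
      rw [rk_delete (by rw [insert_erase hfX]; intro x hx; exact mem_erase.2 ⟨fun h' => hgX (h' ▸ hx), hXg hx⟩),
        insert_erase hfX, hXr] at h
      rw [card_erase_of_mem hfX]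
      omega
    · have hgZ : g ∈ gr M \ X := mem_sdiff.2 ⟨hg, hgX⟩
      have e1 : ((gr M).erase g).erase f \ X.erase f = (gr M \ X).erase g := by
        ext x
        simp only [mem_sdiff, mem_erase]
        constructor
        · rintro ⟨⟨hxf, hxg, hx⟩, hxX⟩
          exact ⟨hxg, hx, fun h => hxX ⟨hxf, h⟩⟩
        · rintro ⟨hxg, hx, hxX⟩
          exact ⟨⟨fun h => hxX (h ▸ hfX), hxg, hx⟩, fun h => hxX h.2⟩
      rw [e1]
      have hsub : (gr M \ X).erase g ⊆ (gr (M ＼ ({g} : Set α))).erase f := by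
        rw [gr_delete']
        intro x hx
        rw [mem_erase, mem_sdiff] at hx
        exact mem_erase.2 ⟨fun h => hx.2.2 (h ▸ hfX), mem_erase.2 ⟨hx.1, hx.2.1⟩⟩
      have h := rk_contract_add_one hfind hsub
      have hsub' : insert f ((gr M \ X).erase g) ⊆ (gr M).erase g := by
        intro x hx
        rw [mem_insert] at hx
        rcases hx with rfl | hx
        · exact mem_erase.2 ⟨hfg', hf⟩
        · rw [mem_erase, mem_sdiff] at hx
          exact mem_erase.2 ⟨hx.1, hx.2.1⟩
      rw [rk_delete hsub', rk_insert_eq_of_parallel' hf hg hf1 hg1 hfg ((erase_subset _ _).trans sdiff_subset),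
        insert_erase hgZ, hXc] at h
      have hc := card_erase_add_one hgZ
      omega
  · intro X hX Y hY h
    rw [mem_filter] at hX hY
    rw [← insert_erase hX.2.1, ← insert_erase hY.2.1, h]
  · intro Y hY
    rw [mem_biIndepSets, hgrT] at hY
    obtain ⟨hYg, hYk, hYr, hYc⟩ := hY
    have hfY : f ∉ Y := fun h => (mem_erase.1 (hYg h)).1 rfl
    have hgY : g ∉ Y := fun h => (mem_erase.1 (mem_erase.1 (hYg h)).2).1 rfl
    have hYg0 : Y ⊆ gr M := fun x hx => (mem_erase.1 (mem_erase.1 (hYg hx)).2).2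
    have hYg1 : Y ⊆ (gr (M ＼ ({g} : Set α))).erase f := by rw [gr_delete']; exact hYg
    refine ⟨insert f Y, ?_, erase_insert hfY⟩
    rw [mem_filter, mem_biIndepSets]
    refine ⟨⟨insert_subset hf hYg0, by rw [card_insert_of_notMem hfY, hYk]; omega, ?_, ?_⟩,
      mem_insert_self _ _, fun h => ?_⟩
    · have h := rk_contract_add_one hfind hYg1
      rw [rk_delete (insert_subset (mem_erase.2 ⟨hfg', hf⟩) (fun x hx => (mem_erase.1 (hYg hx)).2)),
        hYr] at h
      rw [← h, card_insert_of_notMem hfY]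
    · set W := ((gr M).erase g).erase f \ Y with hW
      have e2 : gr M \ insert f Y = insert g W := by
        ext x
        simp only [hW, mem_sdiff, mem_insert, mem_erase, not_or]
        constructor
        · rintro ⟨hx, hxf, hxY⟩
          by_cases hxg : x = g
          · exact Or.inl hxg
          · exact Or.inr ⟨⟨hxf, hxg, hx⟩, hxY⟩
        · rintro (rfl | ⟨⟨hxf, hxg, hx⟩, hxY⟩)
          · exact ⟨hg, hfg'.symm, hgY⟩
          · exact ⟨hx, hxf, hxY⟩
      have hWg : W ⊆ gr M := fun x hx => (mem_erase.1 (mem_erase.1 (mem_sdiff.1 hx).1).2).2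
      have hgW : g ∉ W := fun h => (mem_erase.1 (mem_erase.1 (mem_sdiff.1 h).1).2).1 rfl
      have hWsub : W ⊆ (gr (M ＼ ({g} : Set α))).erase f := by
        rw [gr_delete']
        exact sdiff_subset
      have h := rk_contract_add_one hfind hWsub
      have hsub' : insert f W ⊆ (gr M).erase g := by
        intro x hx
        rw [mem_insert] at hx
        rcases hx with rfl | hx
        · exact mem_erase.2 ⟨hfg', hf⟩
        · exact (mem_erase.1 (mem_sdiff.1 hx).1).2
      rw [rk_delete hsub', rk_insert_eq_of_parallel' hf hg hf1 hg1 hfg hWg, hYc] at h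
      rw [e2, ← h, card_insert_of_notMem hgW]
    · rw [mem_insert] at h
      rcases h with h | h
      · exact hfg' h.symm
      · exact hgY h

/-- **The bi-independent profile at a parallel pair**: for `k ≥ 1`,
`P_k(M) = P_{k−1}((M ∖ e) / p) + P_{k−1}((M ∖ p) / e)`. -/
theorem card_biIndepSets_parallel {p e : α} (hp : p ∈ gr M) (he : e ∈ gr M) (hpe' : p ≠ e)
    (hp1 : rk M {p} = 1) (he1 : rk M {e} = 1) (hpe : rk M {p, e} = 1) {k : ℕ} (hk : 1 ≤ k) :
    (biIndepSets M k).card =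
      (biIndepSets ((M ＼ ({e} : Set α)) ／ ({p} : Set α)) (k - 1)).card +
        (biIndepSets ((M ＼ ({p} : Set α)) ／ ({e} : Set α)) (k - 1)).card := by
  rw [← card_filter_biIndepSets_parallel_half hp he hpe' hp1 he1 hpe hk,
    ← card_filter_biIndepSets_parallel_half he hp hpe'.symm he1 hp1 (by rw [pair_comm]; exact hpe) hk,
    ← card_filter_add_card_filter_not (s := biIndepSets M k) (fun X => p ∈ X)]
  congr 1
  · congr 1
    ext X
    simp only [mem_filter, and_congr_right_iff]
    intro hX
    constructor
    · intro hpX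
      refine ⟨hpX, fun heX => ?_⟩
      rw [mem_biIndepSets] at hX
      exact not_pair_subset_of_parallel' hpe' hpe hX.2.2.1
        (insert_subset hpX (singleton_subset_iff.2 heX))
    · exact fun h => h.1
  · congr 1
    ext X
    simp only [mem_filter, and_congr_right_iff]
    intro hX
    constructor
    · intro hpX
      refine ⟨?_, hpX⟩
      by_contra heX'
      rw [mem_biIndepSets] at hX
      obtain ⟨hXg, -, -, hXc⟩ := hX
      exact not_pair_subset_of_parallel' hpe' hpe hXc
        (insert_subset (mem_sdiff.2 ⟨hp, hpX⟩) (singleton_subset_iff.2 (mem_sdiff.2 ⟨he, heX'⟩)))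
    · exact fun h => h.2

/-- No bi-independent `0`-set at a parallel pair (the ground set is dependent). -/
theorem card_biIndepSets_zero_parallel {p e : α} (hp : p ∈ gr M) (he : e ∈ gr M) (hpe' : p ≠ e)
    (hpe : rk M {p, e} = 1) : (biIndepSets M 0).card = 0 := by
  rw [card_eq_zero, eq_empty_iff_forall_notMem]
  intro X hX
  rw [mem_biIndepSets] at hX
  obtain ⟨-, hXk, -, hXc⟩ := hX
  rw [card_eq_zero.1 hXk, sdiff_empty] at hXc
  exact not_pair_subset_of_parallel' hpe' hpe hXc (insert_subset hp (singleton_subset_iff.2 he))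

/-- **THE POINTED CONJECTURE (Ĉ) HOLDS AT EVERY PARALLEL PAIR** (CONDITIONAL on the named fact): for `p ∥ e` and
`2k + 2 ≤ N`, `(N − k − 1)·P_k ≤ k·P_{k+1} + (N − 2k − 1)·c^p_k` — it is Theorem A at level `k − 1` for the two-element
minors `(M ∖ e) / p` and `(M ∖ p) / e`. -/
theorem pointedRow_parallel_of_fact (hfact : BiIndepDensityLogConcave α) (M : Matroid α) [M.Finite] {p e : α}
    (hp : p ∈ gr M) (he : e ∈ gr M) (hpe' : p ≠ e) (hp1 : rk M {p} = 1) (he1 : rk M {e} = 1)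
    (hpe : rk M {p, e} = 1) (k : ℕ) (hk : 2 * k + 2 ≤ (gr M).card) :
    ((gr M).card - k - 1) * (biIndepSets M k).card ≤
      k * (biIndepSets M (k + 1)).card + ((gr M).card - 2 * k - 1) * extCount M k p := by
  rw [extCount_parallel hp he hpe' hpe k, mul_zero, add_zero]
  rcases Nat.eq_zero_or_pos k with rfl | hk1
  · rw [card_biIndepSets_zero_parallel hp he hpe' hpe]
    simp only [mul_zero, zero_mul, le_refl]
  · have hN1 : (gr ((M ＼ ({e} : Set α)) ／ ({p} : Set α))).card = (gr M).card - 2 := by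
      rw [gr_contract', gr_delete', card_erase_of_mem (mem_erase.2 ⟨hpe', hp⟩), card_erase_of_mem he]
      omega
    have hN2 : (gr ((M ＼ ({p} : Set α)) ／ ({e} : Set α))).card = (gr M).card - 2 := by
      rw [gr_contract', gr_delete', card_erase_of_mem (mem_erase.2 ⟨hpe'.symm, he⟩), card_erase_of_mem hp]
      omega
    rw [card_biIndepSets_parallel hp he hpe' hp1 he1 hpe hk1,
      card_biIndepSets_parallel hp he hpe' hp1 he1 hpe (by omega : 1 ≤ k + 1), show k + 1 - 1 = k by omega]
    have hA1 := biIndepDensity_mono_of_fact hfact ((M ＼ ({e} : Set α)) ／ ({p} : Set α)) (k - 1)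
      (by rw [hN1]; omega)
    have hA2 := biIndepDensity_mono_of_fact hfact ((M ＼ ({p} : Set α)) ／ ({e} : Set α)) (k - 1)
      (by rw [hN2]; omega)
    rw [hN1, show k - 1 + 1 = k by omega, show (gr M).card - 2 - (k - 1) = (gr M).card - k - 1 by omega] at hA1
    rw [hN2, show k - 1 + 1 = k by omega, show (gr M).card - 2 - (k - 1) = (gr M).card - k - 1 by omega] at hA2
    rw [mul_add, mul_add]
    exact Nat.add_le_add hA1 hA2

end PercRepro.Cogirth
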